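import Literature.InformationTheory.Entropy.VonNeumannEntropyOrthogonalSupports
import Literature.MathematicalPhysics.QuantumLattice.SectorPartitionFnCut
import HarnessLib

/-!
# Entropy of a mixture of fermionic states living in distinct particle-number sectors:
# `S(Σ_s q_s ρ_s) = H(q) + Σ_s q_s S(ρ_s)`

Topic `Literature/MathematicalPhysics/QuantumLattice` (namespace = path; family `hubbard`, model-free). The
lattice-fermion instance of `Literature.InformationTheory.Entropy.vonNeumannEntropy_finsetSum_smul_of_orthogonalSupports`
with the SECTOR LABELLING `s ↦ (N↑(s), N↓(s)) = (#upPart s, #downPart s)` of the occupation configurations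
(`spinConfig a b s ↔ label = (a, b)`: `spinConfig_iff_label_eq`; `SectorPartitionFnCut.lean`): density matrices supported in pairwise distinct
spin sectors `(N↑, N↓)` have mutually orthogonal supports, so the entropy of their mixture is the mixing entropy plus
the average entropy [cite: NielsenChuang2010, §11.3.5 eq. (11.83) p.517] — on Fock space this is the statement that a
block-diagonal (number-conserving) box state `σ = ⊕_s q_s ρ_s` has `S(σ) = H(q) + Σ_s q_s S(ρ_s)`, the entropy input
`S⁻ ≤ S(σ)` of the seam-dressed cluster trial states (certificate C3 of the Hubbard `T > 0` family,
sr-mbsolver/hubbard-thermal; kernel reader HOME/hubbard-thermal-p2/C3-READER-SPEC.md §3).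

* **`vonNeumannEntropy_sectorMixture`** — for a finite set `T` of sectors, density matrices `ρ_s` (`tr ρ_s = 1`) with
  `(ρ_s)_{ij} = 0` unless `i, j ∈` sector `s`, and real weights `q_s`:
  `S(Σ_{s∈T} q_s ρ_s) = Σ_{s∈T} (q_s S(ρ_s) + η(q_s))`, `η(t) = −t log t`;
* `le_vonNeumannEntropy_sectorMixture` — the CHECKER form: `q_s ≥ 0`, certified floors `S⁻_s ≤ S(ρ_s)` ⇒
  `Σ_{s∈T} (η(q_s) + q_s S⁻_s) ≤ S(Σ_{s∈T} q_s ρ_s)`.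

Everything is PROVED; no definition (the labelling is the lambda `s ↦ (#upPart s, #downPart s)`), no named fact.

## Tree / Mathlib search

REUSED: `vonNeumannEntropy_finsetSum_smul_of_orthogonalSupports` (`VonNeumannEntropyOrthogonalSupports`, §4),
`spinConfig`, `upPart`, `downPart` (`SectorPartitionFnCut`, `HubbardWave0`). `lean search 'sectorMixture|negMulLog.*spinConfig'`: nothing.
-/

noncomputable section

namespace Literature.MathematicalPhysics.QuantumLattice

open Matrix Finset HubbardWave0 Literature.InformationTheory.Entropy
open scoped ComplexOrder BigOperators

variable {Λ : Type*} [LinearOrder Λ] [Fintype Λ]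

/-- `spinConfig a b s` says that the sector label `(#upPart s, #downPart s)` of the configuration `s` is `(a, b)`.
[cite: LiebPRL1989, proof of Theorem 1] -/
theorem spinConfig_iff_label_eq (a b : ℕ) (s : Finset (Orb Λ)) :
    spinConfig a b s ↔ ((upPart s).card, (downPart s).card) = (a, b) := by
  rw [spinConfig, Prod.mk.injEq]

/-- **Entropy of a mixture of states in distinct spin sectors**: for a finite set `T` of sectors `(N↑, N↓)`,
density matrices `ρ_s` supported in sector `s` (`tr ρ_s = 1`) and real weights `q_s`,
`S(Σ_{s∈T} q_s ρ_s) = Σ_{s∈T} (q_s S(ρ_s) + η(q_s))` — mixing entropy plus average entropy.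
[cite: NielsenChuang2010, §11.3.5 eq. (11.83) p.517] -/
theorem vonNeumannEntropy_sectorMixture (T : Finset (ℕ × ℕ))
    {ρ : ℕ × ℕ → Matrix (Finset (Orb Λ)) (Finset (Orb Λ)) ℂ} (hρ : ∀ s ∈ T, (ρ s).IsHermitian)
    (htr : ∀ s ∈ T, (ρ s).trace = 1)
    (hsupp : ∀ s ∈ T, ∀ i j, ¬ (spinConfig s.1 s.2 i ∧ spinConfig s.1 s.2 j) → ρ s i j = 0) (q : ℕ × ℕ → ℝ) :
    vonNeumannEntropy (∑ s ∈ T, ((q s : ℝ) : ℂ) • ρ s) =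
      ∑ s ∈ T, (q s * vonNeumannEntropy (ρ s) + Real.negMulLog (q s)) := by
  refine vonNeumannEntropy_finsetSum_smul_of_orthogonalSupports
    (fun s : Finset (Orb Λ) => ((upPart s).card, (downPart s).card)) T hρ htr ?_ q
  intro s hs i j h
  refine hsupp s hs i j fun h' => h ⟨?_, ?_⟩
  · exact (spinConfig_iff_label_eq s.1 s.2 i).1 h'.1
  · exact (spinConfig_iff_label_eq s.1 s.2 j).1 h'.2

/-- **The checker form**: nonnegative weights and certified per-sector entropy floors `S⁻_s ≤ S(ρ_s)` give
`Σ_{s∈T} (η(q_s) + q_s S⁻_s) ≤ S(Σ_{s∈T} q_s ρ_s)` (`η(q) = −q log q`; `Σ η(q_s) = H(q)` for a type / probability vector).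
[cite: NielsenChuang2010, §11.3.5 eq. (11.83) p.517] -/
theorem le_vonNeumannEntropy_sectorMixture (T : Finset (ℕ × ℕ))
    {ρ : ℕ × ℕ → Matrix (Finset (Orb Λ)) (Finset (Orb Λ)) ℂ} (hρ : ∀ s ∈ T, (ρ s).IsHermitian)
    (htr : ∀ s ∈ T, (ρ s).trace = 1)
    (hsupp : ∀ s ∈ T, ∀ i j, ¬ (spinConfig s.1 s.2 i ∧ spinConfig s.1 s.2 j) → ρ s i j = 0)
    {q Slo : ℕ × ℕ → ℝ} (hq : ∀ s ∈ T, 0 ≤ q s) (hS : ∀ s ∈ T, Slo s ≤ vonNeumannEntropy (ρ s)) :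
    ∑ s ∈ T, (Real.negMulLog (q s) + q s * Slo s) ≤ vonNeumannEntropy (∑ s ∈ T, ((q s : ℝ) : ℂ) • ρ s) := by
  rw [vonNeumannEntropy_sectorMixture T hρ htr hsupp q]
  refine Finset.sum_le_sum fun s hs => ?_
  have := mul_le_mul_of_nonneg_left (hS s hs) (hq s hs)
  linarith

end Literature.MathematicalPhysics.QuantumLattice

end
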